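import Summits.QuantumFields.YangMills.Theorems.SwapVirialDeficitBlowUpChartDeficitBoxTwisted
import Summits.QuantumFields.YangMills.Theorems.SwapVirialDeficitBlowUpChartDeficitBox
import Summits.QuantumFields.YangMills.Theorems.SwapVirialDeficitBlowUpQuatDeficit
import Summits.QuantumFields.YangMills.Theorems.SwapVirialDeficitLaplaceAbelianLimit
import Summits.QuantumFields.YangMills.Theorems.ToronValleyVolumeLojasiewiczLocaliseSeam
import Literature.MathematicalPhysics.QuantumLattice.GaugeGroups
import Literature.MathematicalPhysics.QuantumFieldTheory.Balaban1983to89.T4HaarSU2Translate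
import Mathlib.Topology.Order.Compact
import HarnessLib

/-!
# W6 (T1)∕(T3), chart half: CONTINUITY of the σ-glued deficit and of the ring chart, EXISTENCE of the FOLLOWER MINIMISER on the compact fibre,
# CONTINUITY of the fibre minimum in the leaders, its LOCATION (`‖U*_f − 1‖_F ≤ 48L³√m`) and the LEADERS' CRUDE FLOOR `sigmaMaxSq C ≤ 1800·L⁶·F̂(C,U)`
# (free-hands support of ⟨stmt-QuantumFields-24197⟩ `SwapVirialDeficit.SwapGluedStiffness`; LEAD ym-line-sfw-p2 g97's steep-window Morse–Bott plan, brick W6)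

LEAD g97's tip treatment (memo `sfw-p2-g97-memo-24197-steep-window-morse-bott.md`, (B-tip)) integrates ONLY the followers exactly at a tip base point:
(T1) `m(P̃) := min_{η_F} F̂` exists (compact fibre) and at a minimiser `‖U_f* − 1‖ ≤ 48L³√m`; (T3) `m(P̃) ≥ sigmaMaxSq(C)/poly` is ✓chartBox's commutator ∕
intertwiner half.  In w2 g57's ring chart `q = (C, U) ∈ SU(2)⁴ × SU(2)^{Fol L}` the fibre IS compact, so everything is elementary once the deficit is CONTINUOUS —
which the tree had only as `Measurable` (✓`measurable_chartDeficit`, via measure preservation).  This file supplies: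

* §1 ★ `continuous_swapRingDeficit` (✓`BlowUp.swapRingDeficit_eq_qDeficit` + ✓`contDiff_qDeficit` + lit ✓`continuous_su2Quat`), `continuous_glue_apply`, ★ `continuous_ringConfig`,
  `continuous_fixHistory`, ★★ `continuous_chartDeficit (z χ)` — the σ-glued deficit is jointly continuous in leaders and followers, every sector and character;
* §2 ★★ `exists_chartDeficit_eq_iInf` — for every leader tuple `C` a FOLLOWER MINIMISER `U₀` with `F̂_z(C,U₀) = m_z(C) := ⨅_U F̂_z(C,U)` exists; `iInf_chartDeficit_le`,
  `iInf_chartDeficit_nonneg`; ★★ `continuous_iInf_chartDeficit` — `C ↦ m_z(C)` is CONTINUOUS (Mathlib `IsCompact.continuous_sInf`), hence `measurable_iInf_chartDeficit`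
  (the base integrand `e^{−b·m(P̃)}` of (T1) is measurable);
* §3 (T1) LOCATION ★★ `follower_minimiser_near_one[_twisted]` — at a minimiser `‖U₀_i − 1‖_F ≤ 48L³·√m_z(C) ≤ 48L³·√F̂_z(C,1)`, and on the sector's near-flat base
  (signed relations `≤ s`) `≤ 832·L⁵·s` (✓`chartDeficit[_twisted]_one_le_of_relations`): the minimiser sits in a polynomially small Frobenius box around the thin toron;
* §4 (T3) THE LEADERS' CRUDE FLOOR ★★ `sigmaMaxSq_le_chartDeficit` — `sigmaMaxSq C ≤ 1800·L⁶·F̂(C,U)` for EVERY follower configuration `U` (✓`chartBox_of_chartDeficit` +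
  ✓`fd_sq_eq_two_mul`: `‖q q′ − q′ q‖² = ½‖CC′ − C′C‖²_F`), hence ★ `sigmaMaxSq_div_le_iInf_chartDeficit` (`sigmaMaxSq C/(1800L⁶) ≤ m(C)`) — w2 g56 ∕ w3 g63's σ-block
  variable `G_σ = sigmaMaxSq` of ✓`lintegral_hubTip_exp_neg_sigmaMaxSq_le` (T4) is dominated by the fibre minimum, polynomially.
What is NOT here: the Taylor floor `F̂ ≥ m + ½(1−δ)⟨A_F u,u⟩` on the sup-box ((T1) second half: jets W4 + fibre Hessian W3), (T2), the tip assembly.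

HONEST LABEL: topology ∕ bookkeeping on landed inequalities; ⟨24197⟩ (window-uniform) ∕ ⟨24196⟩ ∕ ⟨24194⟩ ∕ ⟨24497⟩ OPEN; own crux ⟨22884⟩ OPEN (blocked-on ⟨19935⟩);
no crux, rung of record or summit is proved; the Yang–Mills mass gap is NOT proved; no summit is proved by a line.  THEOREMS ONLY (0 `def`, 0 `sorry`), standard axioms.
Width seat ym-line-sfw-p2-w3 g65 (cell ym-idea-1, free hands), `--supports stmt-QuantumFields-24197`.  References: [cite: Luscher1983, §2]; [cite: tHooft1979]; [folklore].
-/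

set_option autoImplicit false

noncomputable section

open MeasureTheory Set
open scoped BigOperators Quaternion
open Literature.MathematicalPhysics.QuantumFieldTheory hiding SU2
open Literature.MathematicalPhysics.QuantumLattice
open Literature.MathematicalPhysics.QuantumFieldTheory.Balaban1983to89.T4HaarSU2Translate (continuous_su2Quat)

namespace Summit.QuantumFields.YangMills.Theorems.SwapVirialDeficit.BlowUpRing

open Summit.QuantumFields.YangMills.Theorems.FemtoTransferGap
open Summit.QuantumFields.YangMills.Theorems.FemtoTransferGap.TT
open Summit.QuantumFields.YangMills.Theorems.FemtoTransferGap.TwoLattice.Flat (fd)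
open Summit.QuantumFields.YangMills.Theorems.VirialFluxGap.RingDeficit
open Summit.QuantumFields.YangMills.Theorems.VirialFluxGap.FixSplit (FixSpace)
open Summit.QuantumFields.YangMills.Theorems.SwapVirialDeficit.SwapRing
open Summit.QuantumFields.YangMills.Theorems.SwapVirialDeficit.BlowUp (qDeficit contDiff_qDeficit swapRingDeficit_eq_qDeficit)
open Summit.QuantumFields.YangMills.Theorems.SwapVirialDeficit.Abelian (sigmaMax sigmaMaxSq sigmaMax_nonneg)
open Summit.QuantumFields.YangMills.Theorems.ToronValleyVolume.Lojasiewicz (fd_sq_eq_two_mul)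

variable {L : ℕ} [NeZero L]

/-! ## §1 Continuity of the σ-glued deficit and of the ring chart -/

/-- ★ The σ-glued sector deficit `F^S_z` is continuous on ring histories (it is a polynomial in the link quaternions: ✓`swapRingDeficit_eq_qDeficit`,
✓`contDiff_qDeficit`). [cite: Luscher1983, §2] -/
theorem continuous_swapRingDeficit (z : Fin 3 → Bool) : Continuous (swapRingDeficit L z) := by
  have hq : Continuous fun P : (Fin (2 * L - 1 + 1) → GaugeConfig 3 L SU2) × (Site 3 L → SU2) =>
      ((fun i e => su2Quat (P.1 i e), fun x => su2Quat (P.2 x)) : (Fin (2 * L - 1 + 1) → Edge 3 L → ℍ) × (Site 3 L → ℍ)) := by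
    refine Continuous.prodMk (continuous_pi fun i => continuous_pi fun e => ?_) (continuous_pi fun x => ?_)
    · exact continuous_su2Quat.comp ((continuous_apply e).comp ((continuous_apply i).comp continuous_fst))
    · exact continuous_su2Quat.comp ((continuous_apply x).comp continuous_snd)
  have h := (contDiff_qDeficit (L := L) (n := 0) z).continuous.comp hq
  exact h.congr fun P => (swapRingDeficit_eq_qDeficit z P).symm

omit [NeZero L] in
/-- `w ↦ glue w e` is continuous for every link `e` (product topology; cf. ✓`FixField.continuous_glue`, stated for the Frobenius matrix topology). [folklore] -/
theorem continuous_glue_apply (e : Edge 3 L) : Continuous fun w : OffIdx L → SU2 => glue w e := by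
  by_cases he : treeEdge e = true
  · simp only [glue_apply_of_tree _ he]; exact continuous_const
  · simp only [glue_apply_of_not_tree _ he]; exact continuous_apply _

/-- The ring history `(glue w ∷ r, g)` is continuous in `(w, (r, g))`. [folklore] -/
theorem continuous_fixHistory : Continuous (fixHistory (L := L)) := by
  refine Continuous.prodMk (continuous_pi fun i => ?_) (continuous_snd.comp continuous_snd)
  refine Fin.cases ?_ (fun j => ?_) i
  · simp only [Fin.cons_zero]; exact (continuous_pi continuous_glue_apply).comp continuous_fst
  · simp only [Fin.cons_succ]; exact (continuous_apply j).comp (continuous_fst.comp continuous_snd)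

/-- ★ w2 g57's reconstruction map `ringConfig χ : (C, U) ↦ (w, (r, g))` is continuous (every coordinate is a word of length `≤ 3` in the leaders, the followers
and the constant `χ`). [folklore] -/
theorem continuous_ringConfig (χ : Site 3 L → SU2) : Continuous (ringConfig (L := L) χ) := by
  have hA : Continuous fun q : (Fin 4 → SU2) × (Fol L → SU2) => sliceZero (fun μ => q.1 (Fin.castSucc μ)) (fun i => q.2 (Sum.inl i)) := by
    refine continuous_pi fun i => ?_
    by_cases h : isLead i = true
    · refine ((continuous_apply (Fin.castSucc i.1.2)).comp continuous_fst).congr fun q => ?_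
      simp only [Function.comp_apply, sliceZero, dif_pos h]
    · by_cases h2 : i.1.1 i.1.2 = -1
      · refine (((continuous_apply (Fin.castSucc i.1.2)).comp continuous_fst).mul
          ((continuous_apply (Sum.inl ⟨i, h⟩)).comp continuous_snd)).congr fun q => ?_
        simp only [Pi.mul_apply, Function.comp_apply, sliceZero, dif_neg h, letter, if_pos h2]
      · refine ((continuous_apply (Sum.inl ⟨i, h⟩)).comp continuous_snd).congr fun q => ?_
        simp only [Function.comp_apply, sliceZero, dif_neg h, letter, if_neg h2, one_mul]
  have hB : Continuous fun q : (Fin 4 → SU2) × (Fol L → SU2) => fun (j : Fin (2 * L - 1)) (e : Edge 3 L) =>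
      glue (sliceZero (fun μ => q.1 (Fin.castSucc μ)) (fun i => q.2 (Sum.inl i))) e * q.2 (Sum.inr (Sum.inl (j, e))) :=
    continuous_pi fun j => continuous_pi fun e =>
      ((continuous_glue_apply e).comp hA).mul ((continuous_apply _).comp continuous_snd)
  have hC : Continuous fun q : (Fin 4 → SU2) × (Fol L → SU2) => seamField χ (q.1 (Fin.last 3)) (fun x => q.2 (Sum.inr (Sum.inr x))) := by
    refine continuous_pi fun x => ?_
    by_cases hx : x = 0
    · refine ((continuous_apply (Fin.last 3)).comp continuous_fst).congr fun q => ?_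
      simp only [Function.comp_apply, seamField, dif_pos hx]
    · refine (((continuous_const (y := χ x)).mul ((continuous_apply (Fin.last 3)).comp continuous_fst)).mul
        ((continuous_apply (Sum.inr (Sum.inr ⟨x, hx⟩))).comp continuous_snd)).congr fun q => ?_
      simp only [Pi.mul_apply, Function.comp_apply, seamField, dif_neg hx]
  exact hA.prodMk (hB.prodMk hC)

/-- ★★ **The σ-glued deficit is jointly continuous in leaders and followers**: `Continuous (chartDeficit L z χ)` for every sector `z` and character `χ`.
[cite: Luscher1983, §2] -/
theorem continuous_chartDeficit (z : Fin 3 → Bool) (χ : Site 3 L → SU2) : Continuous (chartDeficit L z χ) :=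
  (continuous_swapRingDeficit z).comp (continuous_fixHistory.comp (continuous_ringConfig χ))

/-- The frozen-leader deficit `U ↦ F̂_z(C, U)` is continuous on the (compact) follower fibre. [folklore] -/
theorem continuous_chartDeficit_followers' (z : Fin 3 → Bool) (χ : Site 3 L → SU2) (C : Fin 4 → SU2) :
    Continuous fun U : Fol L → SU2 => chartDeficit L z χ (C, U) :=
  (continuous_chartDeficit z χ).comp (continuous_const.prodMk continuous_id)

/-! ## §2 The follower minimiser and the fibre minimum -/

/-- The fibre values are bounded below (by `0`). [folklore] -/
theorem bddBelow_range_chartDeficit (z : Fin 3 → Bool) (χ : Site 3 L → SU2) (C : Fin 4 → SU2) :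
    BddBelow (Set.range fun U : Fol L → SU2 => chartDeficit L z χ (C, U)) :=
  ⟨0, by rintro _ ⟨U, rfl⟩; exact chartDeficit_nonneg z χ _⟩

/-- `m_z(C) ≤ F̂_z(C, U)` for every `U`. [folklore] -/
theorem iInf_chartDeficit_le (z : Fin 3 → Bool) (χ : Site 3 L → SU2) (C : Fin 4 → SU2) (U : Fol L → SU2) :
    (⨅ U' : Fol L → SU2, chartDeficit L z χ (C, U')) ≤ chartDeficit L z χ (C, U) :=
  ciInf_le (bddBelow_range_chartDeficit z χ C) U

/-- `0 ≤ m_z(C)`. [folklore] -/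
theorem iInf_chartDeficit_nonneg (z : Fin 3 → Bool) (χ : Site 3 L → SU2) (C : Fin 4 → SU2) :
    0 ≤ ⨅ U : Fol L → SU2, chartDeficit L z χ (C, U) :=
  le_ciInf fun _ => chartDeficit_nonneg z χ _

/-- ★★ **EXISTENCE OF THE FOLLOWER MINIMISER** ((T1), first clause): for every leader tuple `C` (every hub, every sign pattern) there is `U₀ ∈ SU(2)^{Fol L}` with
`F̂_z(C, U₀) = m_z(C) = ⨅_U F̂_z(C, U)` — the fibre is compact and the deficit continuous. [cite: Luscher1983, §2] -/
theorem exists_chartDeficit_eq_iInf (z : Fin 3 → Bool) (χ : Site 3 L → SU2) (C : Fin 4 → SU2) :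
    ∃ U₀ : Fol L → SU2, chartDeficit L z χ (C, U₀) = ⨅ U : Fol L → SU2, chartDeficit L z χ (C, U) := by
  obtain ⟨U₀, -, hU₀⟩ := isCompact_univ.exists_isMinOn Set.univ_nonempty (continuous_chartDeficit_followers' z χ C).continuousOn
  exact ⟨U₀, le_antisymm (le_ciInf fun U => (isMinOn_iff.mp hU₀) U (Set.mem_univ U)) (iInf_chartDeficit_le z χ C U₀)⟩

/-- The minimiser minimises. [folklore] -/
theorem exists_follower_minimiser (z : Fin 3 → Bool) (χ : Site 3 L → SU2) (C : Fin 4 → SU2) :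
    ∃ U₀ : Fol L → SU2, ∀ U : Fol L → SU2, chartDeficit L z χ (C, U₀) ≤ chartDeficit L z χ (C, U) := by
  obtain ⟨U₀, h⟩ := exists_chartDeficit_eq_iInf z χ C
  exact ⟨U₀, fun U => h.le.trans (iInf_chartDeficit_le z χ C U)⟩

/-- ★★ **THE FIBRE MINIMUM IS CONTINUOUS IN THE LEADERS**: `C ↦ m_z(C) = ⨅_U F̂_z(C, U)` is continuous on `SU(2)⁴` (minimum of a jointly continuous function over a
compact fibre, Mathlib `IsCompact.continuous_sInf`). [folklore] -/
theorem continuous_iInf_chartDeficit (z : Fin 3 → Bool) (χ : Site 3 L → SU2) :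
    Continuous fun C : Fin 4 → SU2 => ⨅ U : Fol L → SU2, chartDeficit L z χ (C, U) := by
  have h := IsCompact.continuous_sInf (f := fun (C : Fin 4 → SU2) (U : Fol L → SU2) => chartDeficit L z χ (C, U))
    (isCompact_univ : IsCompact (Set.univ : Set (Fol L → SU2))) ((continuous_chartDeficit z χ).comp (continuous_fst.prodMk continuous_snd))
  simpa only [Set.image_univ, sInf_range] using h

/-- The fibre minimum is measurable in the leaders (the base integrand `e^{−b·m}` of (T1) is admissible). [folklore] -/
theorem measurable_iInf_chartDeficit (z : Fin 3 → Bool) (χ : Site 3 L → SU2) :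
    Measurable fun C : Fin 4 → SU2 => ⨅ U : Fol L → SU2, chartDeficit L z χ (C, U) :=
  (continuous_iInf_chartDeficit z χ).measurable

/-! ## §3 (T1) Location of the minimiser: a polynomially small Frobenius box around the thin toron -/

/-- ★★ **LOCATION OF THE FOLLOWER MINIMISER, principal sector**: if `U₀` minimises `F̂(C, ·)` then every follower satisfies
`‖U₀_i − 1‖_F ≤ 48L³·√F̂(C, U₀) ≤ 48L³·√F̂(C, 1)` (✓`chartBox_of_chartDeficit` at the minimiser, then minimality against the thin toron `U ≡ 1`).
[cite: Luscher1983, §2] -/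
theorem follower_minimiser_near_one (C : Fin 4 → SU2) {U₀ : Fol L → SU2}
    (hmin : ∀ U : Fol L → SU2, chartDeficit L (fun _ => false) (fun _ => 1) (C, U₀) ≤ chartDeficit L (fun _ => false) (fun _ => 1) (C, U))
    (i : Fol L) :
    frobNorm (((U₀ i : SU2) : Matrix (Fin 2) (Fin 2) ℂ) - 1) ≤ 48 * (L : ℝ) ^ 3 * Real.sqrt (chartDeficit L (fun _ => false) (fun _ => 1) (C, U₀)) ∧
    frobNorm (((U₀ i : SU2) : Matrix (Fin 2) (Fin 2) ℂ) - 1) ≤ 48 * (L : ℝ) ^ 3 * Real.sqrt (chartDeficit L (fun _ => false) (fun _ => 1) (C, fun _ => 1)) := by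
  have h := (chartBox_of_chartDeficit (L := L) (C, U₀)).2.2 i
  refine ⟨h, h.trans ?_⟩
  gcongr
  exact hmin _

/-- ★★ **LOCATION OF THE FOLLOWER MINIMISER, every sector**: with the sector character `χ_z`, a minimiser `U₀` of `F̂_z(C, ·)` has every follower within
`48L³·√F̂_z(C, U₀) ≤ 48L³·√F̂_z(C, 1)` of the identity (✓`chartBox_of_chartDeficit_twisted`). [cite: tHooft1979] [cite: Luscher1983, §2] -/
theorem follower_minimiser_near_one_twisted (z : Fin 3 → Bool) (C : Fin 4 → SU2) {U₀ : Fol L → SU2}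
    (hmin : ∀ U : Fol L → SU2,
      chartDeficit L z (fun x => centreElem (Bool.xor (z 0 && decide (x 0 ≠ 0)) (Bool.xor (z 1 && decide (x 1 ≠ 0)) (z 2 && decide (x 2 ≠ 0))))) (C, U₀) ≤
        chartDeficit L z (fun x => centreElem (Bool.xor (z 0 && decide (x 0 ≠ 0)) (Bool.xor (z 1 && decide (x 1 ≠ 0)) (z 2 && decide (x 2 ≠ 0))))) (C, U))
    (i : Fol L) :
    frobNorm (((U₀ i : SU2) : Matrix (Fin 2) (Fin 2) ℂ) - 1) ≤ 48 * (L : ℝ) ^ 3 * Real.sqrt (chartDeficit L z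
      (fun x => centreElem (Bool.xor (z 0 && decide (x 0 ≠ 0)) (Bool.xor (z 1 && decide (x 1 ≠ 0)) (z 2 && decide (x 2 ≠ 0))))) (C, U₀)) ∧
    frobNorm (((U₀ i : SU2) : Matrix (Fin 2) (Fin 2) ℂ) - 1) ≤ 48 * (L : ℝ) ^ 3 * Real.sqrt (chartDeficit L z
      (fun x => centreElem (Bool.xor (z 0 && decide (x 0 ≠ 0)) (Bool.xor (z 1 && decide (x 1 ≠ 0)) (z 2 && decide (x 2 ≠ 0))))) (C, fun _ => 1)) := by
  have h := (chartBox_of_chartDeficit_twisted (L := L) z (C, U₀)).2.2 i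
  refine ⟨h, h.trans ?_⟩
  gcongr
  exact hmin _

omit [NeZero L] in
/-- `√(300·L⁴·s²) ≤ (52/3)·L²·s` for `s ≥ 0` (`(52/3)² = 2704/9 ≥ 300`). [folklore] -/
theorem sqrt_thinToron_le {s : ℝ} (hs : 0 ≤ s) : Real.sqrt (300 * (L : ℝ) ^ 4 * s ^ 2) ≤ 52 / 3 * (L : ℝ) ^ 2 * s := by
  have hL : (0 : ℝ) ≤ (L : ℝ) ^ 2 := by positivity
  have h0 : 0 ≤ 52 / 3 * (L : ℝ) ^ 2 * s := by positivity
  calc Real.sqrt (300 * (L : ℝ) ^ 4 * s ^ 2) ≤ Real.sqrt ((52 / 3 * (L : ℝ) ^ 2 * s) ^ 2) :=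
        Real.sqrt_le_sqrt (by nlinarith [mul_nonneg (mul_nonneg hL hL) (sq_nonneg s)])
    _ = 52 / 3 * (L : ℝ) ^ 2 * s := Real.sqrt_sq h0

/-- ★★ **ON THE NEAR-FLAT BASE THE MINIMISER IS POLYNOMIALLY CLOSE TO THE THIN TORON** (every sector): commutators `≤ s` and SIGNED σ-relations
`‖c·C_{σμ} − centreElem(z μ)·C_μ·c‖_F ≤ s` ⟹ every follower of a minimiser satisfies `‖U₀_i − 1‖_F ≤ 832·L⁵·s`
(✓`chartDeficit_twisted_one_le_of_relations`: `F̂_z(C,1) ≤ 300L⁴s²`, and `48·√300 ≤ 832`). [cite: tHooft1979] [cite: Luscher1983, §2] -/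
theorem follower_minimiser_near_one_of_relations (z : Fin 3 → Bool) (C : Fin 4 → SU2) {s : ℝ} (hs : 0 ≤ s)
    (hCC : ∀ μ ν : Fin 3, frobNorm (((C (Fin.castSucc μ) * C (Fin.castSucc ν) : SU2) : Matrix (Fin 2) (Fin 2) ℂ) -
        ((C (Fin.castSucc ν) * C (Fin.castSucc μ) : SU2) : Matrix (Fin 2) (Fin 2) ℂ)) ≤ s)
    (hσ : ∀ μ : Fin 3, frobNorm (((C (Fin.last 3) * C (Fin.castSucc (Equiv.swap (0 : Fin 3) 1 μ)) : SU2) : Matrix (Fin 2) (Fin 2) ℂ) -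
        ((centreElem (z μ) * C (Fin.castSucc μ) * C (Fin.last 3) : SU2) : Matrix (Fin 2) (Fin 2) ℂ)) ≤ s)
    {U₀ : Fol L → SU2}
    (hmin : ∀ U : Fol L → SU2,
      chartDeficit L z (fun x => centreElem (Bool.xor (z 0 && decide (x 0 ≠ 0)) (Bool.xor (z 1 && decide (x 1 ≠ 0)) (z 2 && decide (x 2 ≠ 0))))) (C, U₀) ≤
        chartDeficit L z (fun x => centreElem (Bool.xor (z 0 && decide (x 0 ≠ 0)) (Bool.xor (z 1 && decide (x 1 ≠ 0)) (z 2 && decide (x 2 ≠ 0))))) (C, U))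
    (i : Fol L) :
    frobNorm (((U₀ i : SU2) : Matrix (Fin 2) (Fin 2) ℂ) - 1) ≤ 832 * (L : ℝ) ^ 5 * s := by
  have h := (follower_minimiser_near_one_twisted (L := L) z C hmin i).2
  have hthin := chartDeficit_twisted_one_le_of_relations (L := L) z C hs hCC hσ
  have hL : (0 : ℝ) ≤ (L : ℝ) ^ 3 := by positivity
  calc frobNorm (((U₀ i : SU2) : Matrix (Fin 2) (Fin 2) ℂ) - 1)
      ≤ 48 * (L : ℝ) ^ 3 * Real.sqrt (300 * (L : ℝ) ^ 4 * s ^ 2) := h.trans (by gcongr)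
    _ ≤ 48 * (L : ℝ) ^ 3 * (52 / 3 * (L : ℝ) ^ 2 * s) := by gcongr; exact sqrt_thinToron_le hs
    _ = 832 * (L : ℝ) ^ 5 * s := by ring

/-- ★ The fibre minimum on the near-flat base: `m_z(C) ≤ F̂_z(C, 1) ≤ 300·L⁴·s²`. [cite: Luscher1983, §2] -/
theorem iInf_chartDeficit_le_of_relations (z : Fin 3 → Bool) (C : Fin 4 → SU2) {s : ℝ} (hs : 0 ≤ s)
    (hCC : ∀ μ ν : Fin 3, frobNorm (((C (Fin.castSucc μ) * C (Fin.castSucc ν) : SU2) : Matrix (Fin 2) (Fin 2) ℂ) -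
        ((C (Fin.castSucc ν) * C (Fin.castSucc μ) : SU2) : Matrix (Fin 2) (Fin 2) ℂ)) ≤ s)
    (hσ : ∀ μ : Fin 3, frobNorm (((C (Fin.last 3) * C (Fin.castSucc (Equiv.swap (0 : Fin 3) 1 μ)) : SU2) : Matrix (Fin 2) (Fin 2) ℂ) -
        ((centreElem (z μ) * C (Fin.castSucc μ) * C (Fin.last 3) : SU2) : Matrix (Fin 2) (Fin 2) ℂ)) ≤ s) :
    (⨅ U : Fol L → SU2, chartDeficit L z
        (fun x => centreElem (Bool.xor (z 0 && decide (x 0 ≠ 0)) (Bool.xor (z 1 && decide (x 1 ≠ 0)) (z 2 && decide (x 2 ≠ 0))))) (C, U)) ≤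
      300 * (L : ℝ) ^ 4 * s ^ 2 :=
  (iInf_chartDeficit_le z _ C (fun _ => 1)).trans (chartDeficit_twisted_one_le_of_relations (L := L) z C hs hCC hσ)

/-! ## §4 (T3) The leaders' crude floor: `sigmaMaxSq C ≤ 1800·L⁶·F̂(C,U)` for every `U` -/

omit [NeZero L] in
/-- `‖q(V) − q(W)‖ ≤ √(K)` from `‖V − W‖_F ≤ 60L³√F` with `K = 1800·L⁶·F` (`fd² = 2‖Δq‖²`). [folklore] -/
theorem norm_su2Quat_sub_le_sqrt_of_frobNorm_le (V W : SU2) {F : ℝ} (hF : 0 ≤ F)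
    (h : frobNorm ((V : Matrix (Fin 2) (Fin 2) ℂ) - (W : Matrix (Fin 2) (Fin 2) ℂ)) ≤ 60 * (L : ℝ) ^ 3 * Real.sqrt F) :
    ‖su2Quat V - su2Quat W‖ ≤ Real.sqrt (1800 * (L : ℝ) ^ 6 * F) := by
  have hfd : fd V W ≤ 60 * (L : ℝ) ^ 3 * Real.sqrt F := h
  have hfd0 : 0 ≤ fd V W := frobNorm_nonneg _
  have hsq : fd V W ^ 2 ≤ (60 * (L : ℝ) ^ 3 * Real.sqrt F) ^ 2 := pow_le_pow_left₀ hfd0 hfd 2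
  have hFs : Real.sqrt F ^ 2 = F := Real.sq_sqrt hF
  have h2 := fd_sq_eq_two_mul V W
  have hK : (60 * (L : ℝ) ^ 3 * Real.sqrt F) ^ 2 = 3600 * (L : ℝ) ^ 6 * F := by rw [mul_pow, mul_pow, hFs]; ring
  refine (Real.le_sqrt (norm_nonneg _) (by positivity)).2 ?_
  nlinarith [hsq, hK, h2]

/-- ★★ **(T3) THE LEADERS' CRUDE FLOOR**: for every chart point `q = (C, U)`, `sigmaMaxSq C ≤ 1800·L⁶·F̂(C, U)` — the σ-block variable `G_σ = sigmaMaxSq` of the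
zero-mode analysis (✓`tendsto_laplace_sigmaTwisted`, ✓`lintegral_hubTip_exp_neg_sigmaMaxSq_le`) is dominated by the chart deficit at EVERY follower configuration
(✓`chartBox_of_chartDeficit`: all twelve relations `≤ 60L³√F̂` in Frobenius norm, `= ½·` that in quaternion norm). [cite: Luscher1983, §2] [cite: tHooft1979] -/
theorem sigmaMaxSq_le_chartDeficit (q : (Fin 4 → SU2) × (Fol L → SU2)) :
    sigmaMaxSq q.1 ≤ 1800 * (L : ℝ) ^ 6 * chartDeficit L (fun _ => false) (fun _ => 1) q := by
  obtain ⟨hCC, hσ, -⟩ := chartBox_of_chartDeficit (L := L) q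
  set F : ℝ := chartDeficit L (fun _ => false) (fun _ => 1) q with hFdef
  have hF : 0 ≤ F := chartDeficit_nonneg _ _ q
  have hmax : sigmaMax q.1 ≤ Real.sqrt (1800 * (L : ℝ) ^ 6 * F) := by
    rw [sigmaMax, max_le_iff, ciSup_le_iff (Finite.bddAbove_range _), ciSup_le_iff (Finite.bddAbove_range _)]
    refine ⟨fun p => ?_, fun μ => ?_⟩
    · rw [← su2Quat_mul, ← su2Quat_mul]
      exact norm_su2Quat_sub_le_sqrt_of_frobNorm_le _ _ hF (hCC p.1 p.2)
    · rw [← su2Quat_mul, ← su2Quat_mul]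
      exact norm_su2Quat_sub_le_sqrt_of_frobNorm_le _ _ hF (hσ μ)
  calc sigmaMaxSq q.1 = sigmaMax q.1 ^ 2 := rfl
    _ ≤ Real.sqrt (1800 * (L : ℝ) ^ 6 * F) ^ 2 := pow_le_pow_left₀ (sigmaMax_nonneg _) hmax 2
    _ = 1800 * (L : ℝ) ^ 6 * F := Real.sq_sqrt (by positivity)

/-- ★ **(T3) for the fibre minimum**: `sigmaMaxSq C/(1800·L⁶) ≤ m(C) = ⨅_U F̂(C, U)` — the follower-minimised deficit still controls the leaders' σ-relations
polynomially (input of LEAD g97's tip assembly: `e^{−b·m(P̃)} ≤ e^{−(b/1800L⁶)·G_σ}`, feeding ✓`lintegral_hubTip_exp_neg_sigmaMaxSq_le`). [cite: Luscher1983, §2] -/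
theorem sigmaMaxSq_div_le_iInf_chartDeficit (C : Fin 4 → SU2) :
    sigmaMaxSq C / (1800 * (L : ℝ) ^ 6) ≤ ⨅ U : Fol L → SU2, chartDeficit L (fun _ => false) (fun _ => 1) (C, U) := by
  have hL : (0 : ℝ) < L := by exact_mod_cast NeZero.pos L
  have hK : (0 : ℝ) < 1800 * (L : ℝ) ^ 6 := by positivity
  refine le_ciInf fun U => ?_
  rw [div_le_iff₀ hK, mul_comm]
  exact sigmaMaxSq_le_chartDeficit (L := L) (C, U)

/-- ★ Pointwise form for the tip integrand: `e^{−b·F̂(C,U)} ≤ e^{−(b/(1800L⁶))·sigmaMaxSq C}` for `b ≥ 0`, every `U`. [cite: Luscher1983, §2] -/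
theorem exp_neg_mul_chartDeficit_le_exp_sigmaMaxSq (q : (Fin 4 → SU2) × (Fol L → SU2)) {b : ℝ} (hb : 0 ≤ b) :
    Real.exp (-(b * chartDeficit L (fun _ => false) (fun _ => 1) q)) ≤ Real.exp (-(b / (1800 * (L : ℝ) ^ 6) * sigmaMaxSq q.1)) := by
  have hL : (0 : ℝ) < L := by exact_mod_cast NeZero.pos L
  have hK : (0 : ℝ) < 1800 * (L : ℝ) ^ 6 := by positivity
  have h := sigmaMaxSq_le_chartDeficit (L := L) q
  rw [Real.exp_le_exp, neg_le_neg_iff]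
  calc b / (1800 * (L : ℝ) ^ 6) * sigmaMaxSq q.1 ≤ b / (1800 * (L : ℝ) ^ 6) * (1800 * (L : ℝ) ^ 6 * chartDeficit L (fun _ => false) (fun _ => 1) q) :=
        mul_le_mul_of_nonneg_left h (div_nonneg hb hK.le)
    _ = b * chartDeficit L (fun _ => false) (fun _ => 1) q := by field_simp

end Summit.QuantumFields.YangMills.Theorems.SwapVirialDeficit.BlowUpRing

end
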